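/-
Copyright (c) 2026 the pub-hodgecm-mathlib formalisation cell (harness21).  Prover seat hodgecm-mathlib-K2E3-p14 (g4) (free E3 hand on the E1 campaign
«EIS-RANK-ONE», deal [D2] (d₃-b-i) of K2E1-plan (g3) 2026-09-04T05:38:45Z), h413 = `stmt-HodgeConjecture-24833`, rung R6d₃: THE GROUP HALF OF THE DILATION
BOUND ON `U(J₃)` — along `g = heis(X_u, t_u)·t·k` the big-cell function DILATES ON THE HEISENBERG GROUP, `Φ_g(X, s) = m·Φ_k(λ₁(X + X_u), λ₂(s + t_u + y(X)))`.
2026-09-04.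
-/
import Summits.HodgeConjecture.HodgeConjecture.Theorems.K2E1EisensteinMinusConstantTermBoundU3   -- ★ p857726 (this seat): part (b)₃, the `hdil` consumer
import Summits.HodgeConjecture.HodgeConjecture.Theorems.K2E1BigCellLineDilationU2               -- ★ p857599 (K2E1-p02 (g5)): the `N = 2` template, `norm_chi_mul_ideleNorm_cpow`
import Literature.NumberTheory.Automorphic.UnitaryGroupHeisenbergFibreTorusConj                 -- ★ `coe_torus_inv_mul_heisChart_mul` (`t⁻¹ heis(x,y′) t`)
import Literature.NumberTheory.Automorphic.UnitaryGroupTorusIdeleUnfoldingCentral               -- ★ `ideleNorm_diagUnitRatio_eq` (`‖d₀d₁⁻¹‖ = ‖d₀‖`)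
import Literature.NumberTheory.Automorphic.UnitaryGroupRankOneBigCell                           -- ★ `weylLongU_mul_weylLongU`, `coe_coe_weylLongU_three`
import HarnessLib

/-!
# h413 ∕ Track B «K2-LIT», «EIS-RANK-ONE» R6d₃ (b-i) — helper `K2E1BigCellHeisenbergDilationU3`:
# the dilation of the big-cell function along `g = u·t·k` on `U(J₃)` (the structure hypothesis `hdil` of ★ p857726 from the group law)

Cell `pub/hodgecm-mathlib`, crux H413 = `stmt-HodgeConjecture-24833`, route `HCCMUnconditional`; DEAL [D2] (d₃-b-i) of the dealer K2E1-plan (g3) (the `N = 3` twin of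
★ p857599 `K2E1BigCellLineDilationU2`).  THEOREMS ONLY (no `def`, no `instance`, no `notation`, no named-fact hypothesis, no `sorry`); lane
`--kind proof --supports stmt-HodgeConjecture-24833 --as helper` (count-neutral).

THE COMPUTATION (Rogawski §1.10; Garrett §2.9 at rank one).  In `U(J₃)(𝔸_F)` write `u(X, y′) = heisChart (X, y′)` (`X ∈ 𝔸_E`, `y′ ∈ 𝔸_E⁻ = θ(𝔸_F)`,
`θ = traceZeroLine`), `w₀ = weylLongU` (`w₀² = 1`, §1) and `t = diag(d₀, d₁, d₂) ∈ T(𝔸_F)`.  Then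
* HEISENBERG LAW IN THE CHART (§2): `u(X, θ s)·u(X_u, θ t_u) = u(X + X_u, θ(s + t_u + y))` with the cross term `θ y = ½(X_u c(X) − X c(X_u))`
  (`y = θ⁻¹(coordY(u(X,0)·u(X_u,0)))`; ★ `coordX_mul_heisChart`, ★ `coe_coordY_mul_heisChart`);
* TORUS CONJUGATION (§3): `t⁻¹·u(X, θ s)·t = u((d₀⁻¹d₁)X, θ(Λ₂ s))` for the `F`-idele `Λ₂` with `(Λ₂)_E = d₀⁻¹d₂` (★ `coe_torus_inv_mul_heisChart_mul`,
  ★ `traceZeroLine_units_mul`; `Λ₂` EXISTS: §5, quadratic descent ★ `exists_baseChange_eq_of_conjAdele_eq` — it is `N_{E∕F}(d₀)⁻¹`);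
* THE LONG WEYL ELEMENT (§1): `w₀ t w₀ = diag(d₂, d₁, d₀) ∈ B(𝔸_F)` with `diagUnit 0 = d₂`;
so for a Borel section `f` of exponent `z` (`f(b g) = χ(b₀₀)‖b₀₀‖^z f(g)`, `b ∈ B(𝔸_F)`):
`f(w₀·u(X, θ s)·(u(X_u, θ t_u)·t·k)) = χ(d₂)‖d₂‖_E^z · f(w₀·u((d₀⁻¹d₁)(X − (−X_u)), θ(Λ₂(s − (−(t_u + y)))))·k)` (**`bigCell_heisenberg_dilation_three`**, §4) —
the `hdil` of ★ p857726 with `m = χ(d₂)‖d₂‖^z`, `λ₁ = d₀⁻¹d₁`, `λ₂ = Λ₂`, `Y = −X_u`, `y(X) = −(t_u + y)`.  §5 supplies the scalar bookkeeping for the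
power-law forms: `‖d₁‖ = 1`, `‖d₂‖ = ‖d₀‖⁻¹`, `|Λ₂|_F = ‖d₀‖⁻¹ = |d₀⁻¹d₁|_E` and `‖m‖ = |Λ₂|_F^{Re z}` (**`norm_multiplier_eq_rpow_three`**).

HONEST LABEL.  Count-neutral helper; proves no printed statement; HC_CM is proved only modulo the 7 printed citations (2 remaining named inputs: hLiu418 =
`stmt-HodgeConjecture-24832`, h413 = `stmt-HodgeConjecture-24833`) until rung 0 closes.

## References
* [Rogawski1990] J. Rogawski, *Automorphic Representations of Unitary Groups in Three Variables* (1990), §1.10.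
* [Garrett2018] P. Garrett, *Modern Analysis of Automorphic Forms by Example*, vol. 1 (2018), §2.9.
* [CasselsFrohlichANT1967] J. W. S. Cassels, A. Fröhlich (eds.), *Algebraic Number Theory* (1967), Ch. II §14.
-/

set_option autoImplicit false
set_option linter.dupNamespace false  -- the mandated namespace repeats the summit's segment (`HodgeConjecture.HodgeConjecture`)

noncomputable section

open scoped Matrix NNReal
open MeasureTheory NumberField IsDedekindDomain MulAction
open Literature.NumberTheory.Automorphic Literature.NumberTheory.Automorphic.UnitaryGroup Literature.NumberTheory.GaloisRepresentations
open Summit.HodgeConjecture.HodgeConjecture.Cruxes.H413.K2E1BorelEisensteinU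
open Summit.HodgeConjecture.HodgeConjecture.Cruxes.H413.K2E1BigCellLineDilationU2

namespace Summit.HodgeConjecture.HodgeConjecture.Cruxes.H413.K2E1BigCellHeisenbergDilationU3

variable {F E : Type} [Field F] [NumberField F] [Field E] [NumberField E] [Algebra F E] [Algebra.IsQuadraticExtension F E] {c : E ≃ₐ[F] E}
  {δ : E}

/-! ## §1 The long Weyl element of `U(J₃)` against the torus -/

omit [Algebra.IsQuadraticExtension F E] in
/-- `ι(w₀) · ι(w₀) = 1` adelically on `U(J₃)` (★ `weylLongU_mul_weylLongU`). [cite: Rogawski1990, §1.10] -/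
theorem toAdelic_weylLongU_mul_self_three :
    (quasiSplit F E c 3).toAdelic (weylLongU (c : E →+* E) (rfl : (StdForm.antidiagonal 3).over E = (StdForm.antidiagonal 3).over E)) *
        (quasiSplit F E c 3).toAdelic (weylLongU (c : E →+* E) (rfl : (StdForm.antidiagonal 3).over E = (StdForm.antidiagonal 3).over E)) = 1 := by
  have h := congrArg (quasiSplit F E c 3).toAdelic
    (weylLongU_mul_weylLongU (c : E →+* E) (rfl : (StdForm.antidiagonal 3).over E = (StdForm.antidiagonal 3).over E))
  exact (map_mul _ _ _).symm.trans (h.trans (map_one _))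

omit [Algebra.IsQuadraticExtension F E] in
/-- The adelic matrix of `ι(w₀)` is `antidiag(1, 1, 1)`: entry `(i, j)` is `1` if `i + j = 2` and `0` otherwise. [cite: Rogawski1990, §1.10] -/
theorem adelicVal_toAdelic_weylLongU_apply_three (i j : Fin 3) :
    ((adelicVal F E c 3 _ ((quasiSplit F E c 3).toAdelic (weylLongU (c : E →+* E) (rfl : (StdForm.antidiagonal 3).over E = (StdForm.antidiagonal 3).over E))) :
        GL (Fin 3) (AdeleRing (𝓞 E) E)) : Matrix (Fin 3) (Fin 3) (AdeleRing (𝓞 E) E)) i j = if i.val + j.val = 2 then 1 else 0 := by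
  change algebraMap E (AdeleRing (𝓞 E) E) ((((weylLongU (c : E →+* E) (rfl : (StdForm.antidiagonal 3).over E = (StdForm.antidiagonal 3).over E) :
      ↥(unitaryGroupOfForm (c : E →+* E) ((StdForm.antidiagonal 3).over E))) : GL (Fin 3) E) : Matrix (Fin 3) (Fin 3) E) i j) = _
  rw [coe_coe_weylLongU_three]
  fin_cases i <;> fin_cases j <;> simp

omit [Algebra.IsQuadraticExtension F E] in
/-- **`w₀ t w₀ = diag(d₂, d₁, d₀)`** entrywise, for `t = diag(d₀, d₁, d₂) ∈ T(𝔸_F)` (★ `adelicVal` currency). [cite: Rogawski1990, §1.10] -/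
theorem adelicVal_weylLong_conj_torus_apply_three (t : ↥(torusInBorel F E c 3)) {d : Fin 3 → (AdeleRing (𝓞 E) E)ˣ}
    (hd : glDiagonal 3 (AdeleRing (𝓞 E) E) d = adelicVal F E c 3 _ ((t : borelAdelic F E c 3) : (quasiSplit F E c 3).Adelic)) (i j : Fin 3) :
    ((adelicVal F E c 3 _ (((quasiSplit F E c 3).toAdelic (weylLongU (c : E →+* E) (rfl : (StdForm.antidiagonal 3).over E = (StdForm.antidiagonal 3).over E))) *
        ((t : borelAdelic F E c 3) : (quasiSplit F E c 3).Adelic) *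
        ((quasiSplit F E c 3).toAdelic (weylLongU (c : E →+* E) (rfl : (StdForm.antidiagonal 3).over E = (StdForm.antidiagonal 3).over E)))) :
        GL (Fin 3) (AdeleRing (𝓞 E) E)) : Matrix (Fin 3) (Fin 3) (AdeleRing (𝓞 E) E)) i j = if i = j then (d i.rev : AdeleRing (𝓞 E) E) else 0 := by
  have hW := adelicVal_toAdelic_weylLongU_apply_three (F := F) (E := E) (c := c)
  have hT : ∀ i j : Fin 3, ((adelicVal F E c 3 _ ((t : borelAdelic F E c 3) : (quasiSplit F E c 3).Adelic) : GL (Fin 3) (AdeleRing (𝓞 E) E)) :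
      Matrix (Fin 3) (Fin 3) (AdeleRing (𝓞 E) E)) i j = if i = j then (d i : AdeleRing (𝓞 E) E) else 0 := fun i j => by
    rw [← hd, coe_glDiagonal, Matrix.diagonal_apply]
  rw [map_mul, map_mul, Units.val_mul, Units.val_mul]
  simp only [Matrix.mul_apply, Fin.sum_univ_three, hW, hT]
  fin_cases i <;> fin_cases j <;> simp [Fin.rev]

omit [Algebra.IsQuadraticExtension F E] in
/-- `w₀ t w₀ ∈ B(𝔸_F)` (it is diagonal). [cite: Rogawski1990, §1.10] -/
theorem weylLong_conj_torus_mem_borelAdelic_three (t : ↥(torusInBorel F E c 3)) :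
    ((quasiSplit F E c 3).toAdelic (weylLongU (c : E →+* E) (rfl : (StdForm.antidiagonal 3).over E = (StdForm.antidiagonal 3).over E))) *
        ((t : borelAdelic F E c 3) : (quasiSplit F E c 3).Adelic) *
        ((quasiSplit F E c 3).toAdelic (weylLongU (c : E →+* E) (rfl : (StdForm.antidiagonal 3).over E = (StdForm.antidiagonal 3).over E))) ∈
      borelAdelic F E c 3 := by
  rw [mem_borelAdelic_iff]
  intro i j hij
  rw [adelicVal_weylLong_conj_torus_apply_three t (glDiagonal_diagUnit_torus t)]
  exact if_neg (ne_of_gt hij)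

omit [Algebra.IsQuadraticExtension F E] in
/-- `diagUnit (w₀ t w₀) 0 = d₂`. [cite: Rogawski1990, §1.10] -/
theorem diagUnit_weylLong_conj_torus_zero_three (t : ↥(torusInBorel F E c 3)) :
    diagUnit (weylLong_conj_torus_mem_borelAdelic_three t) 0 = diagUnit (t : borelAdelic F E c 3).2 2 :=
  Units.ext (by rw [coe_diagUnit, adelicVal_weylLong_conj_torus_apply_three t (glDiagonal_diagUnit_torus t), if_pos rfl]; rfl)

/-! ## §2 The Heisenberg law in the chart -/

omit [Algebra.IsQuadraticExtension F E] in
/-- **`u(X, y′)·u(X_u, y′_u) = u(X + X_u, y′ + y′_u + y×)`** with the CROSS TERM `y× = coordY(u(X, 0)·u(X_u, 0)) = ½(X_u c(X) − X c(X_u)) ∈ 𝔸_E⁻`.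
[cite: Rogawski1990, §1.10] -/
theorem heisChart_mul_heisChart (hc : c * c = 1) (X Xu : AdeleRing (𝓞 E) E) (y yu : traceZeroAdele F E c) :
    heisChart hc (X, y) * heisChart hc (Xu, yu) =
      heisChart hc (X + Xu, y + yu + coordY hc (heisChart hc (X, (0 : traceZeroAdele F E c)) * heisChart hc (Xu, (0 : traceZeroAdele F E c)))) := by
  rw [← heisChart_coord hc (heisChart hc (X, y) * heisChart hc (Xu, yu))]
  congr 1
  refine Prod.ext ?_ (Subtype.ext ?_)
  · rw [coordX_mul_heisChart, coordX_heisChart]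
  · simp only [coe_coordY_mul_heisChart, coordX_heisChart, coordY_heisChart, AddSubgroup.coe_add, ZeroMemClass.coe_zero, zero_add]
    ring

/-- The same in the `θ = traceZeroLine` coordinate on `𝔸_E⁻`: `u(X, θ s)·u(X_u, θ t_u) = u(X + X_u, θ(s + t_u + θ⁻¹ y×))`. [cite: Rogawski1990, §1.10] -/
theorem heisChart_traceZeroLine_mul (hc : c * c = 1) (hcδ : c δ = -δ) (hδ : δ ≠ 0) (X Xu : AdeleRing (𝓞 E) E) (s tu : AdeleRing (𝓞 F) F) :
    heisChart hc (X, traceZeroLine F E c hcδ hδ s) * heisChart hc (Xu, traceZeroLine F E c hcδ hδ tu) =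
      heisChart hc (X + Xu, traceZeroLine F E c hcδ hδ (s + tu +
        (traceZeroLine F E c hcδ hδ).symm (coordY hc (heisChart hc (X, (0 : traceZeroAdele F E c)) * heisChart hc (Xu, (0 : traceZeroAdele F E c)))))) := by
  rw [heisChart_mul_heisChart, map_add, map_add, ContinuousAddEquiv.apply_symm_apply]

/-! ## §3 Torus conjugation in the `θ`-coordinate -/

/-- **`t⁻¹·u(X, θ s)·t = u((d₀⁻¹d₁)X, θ(Λ₂ s))`** for the `F`-idele `Λ₂` with `(Λ₂)_E = d₀⁻¹d₂` (★ `coe_torus_inv_mul_heisChart_mul`, ★ `traceZeroLine_units_mul`).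
[cite: Rogawski1990, §1.10] -/
theorem torus_inv_mul_heisChart_traceZeroLine_mul_torus (hc : c * c = 1) (hcδ : c δ = -δ) (hδ : δ ≠ 0) (t : ↥(torusInBorel F E c 3))
    (Λ₂ : (AdeleRing (𝓞 F) F)ˣ)
    (hΛ₂ : ((AdeleRing.ideleBaseChange F E Λ₂ : (AdeleRing (𝓞 E) E)ˣ) : AdeleRing (𝓞 E) E) = (((diagUnit (t : borelAdelic F E c 3).2 0)⁻¹ * diagUnit (t : borelAdelic F E c 3).2 2 : (AdeleRing (𝓞 E) E)ˣ) : AdeleRing (𝓞 E) E))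
    (X : AdeleRing (𝓞 E) E) (s : AdeleRing (𝓞 F) F) :
    ((t : borelAdelic F E c 3) : (quasiSplit F E c 3).Adelic)⁻¹ * ((heisChart hc (X, traceZeroLine F E c hcδ hδ s) : adelicUnipotent F E c 3) : (quasiSplit F E c 3).Adelic) * ((t : borelAdelic F E c 3) : (quasiSplit F E c 3).Adelic) =
      ((heisChart hc ((((diagUnit (t : borelAdelic F E c 3).2 0)⁻¹ * diagUnit (t : borelAdelic F E c 3).2 1 : (AdeleRing (𝓞 E) E)ˣ) : AdeleRing (𝓞 E) E) * X, traceZeroLine F E c hcδ hδ ((Λ₂ : AdeleRing (𝓞 F) F) * s)) : adelicUnipotent F E c 3) : (quasiSplit F E c 3).Adelic) := by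
  have hsm : smulTraceZero ((diagUnit (t : borelAdelic F E c 3).2 0)⁻¹ * diagUnit (t : borelAdelic F E c 3).2 2) (conjAdele_torusCentralScalar t (glDiagonal_diagUnit_torus t)) (traceZeroLine F E c hcδ hδ s) =
      traceZeroLine F E c hcδ hδ ((Λ₂ : AdeleRing (𝓞 F) F) * s) := by
    rw [traceZeroLine_units_mul]
    exact Subtype.ext (by rw [coe_smulTraceZero, coe_smulTraceZero, hΛ₂])
  rw [coe_torus_inv_mul_heisChart_mul hc t, hsm]

/-! ## §4 The dilation of the big-cell function along `g = heis(X_u, θ t_u)·t·k` -/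

/-- **THE GROUP HALF OF THE DILATION BOUND ON `U(J₃)` (`hdil` of ★ p857726).**  For a Borel section `f` of exponent `z` (`f(b g) = χ(b₀₀)‖b₀₀‖_E^z f(g)` for
`b ∈ B(𝔸_F)`, `b₀₀ = diagUnit hb 0`), `t = diag(d₀, d₁, d₂) ∈ T(𝔸_F)`, an `F`-idele `Λ₂` with `(Λ₂)_E = d₀⁻¹d₂`, `X_u ∈ 𝔸_E`, `t_u ∈ 𝔸_F` and any `k`:
`f(w₀·u(X, θ s)·(u(X_u, θ t_u)·t·k)) = χ(d₂)‖d₂‖_E^z · f(w₀·u((d₀⁻¹d₁)(X − (−X_u)), θ(Λ₂(s − (−(t_u + θ⁻¹y×)))))·k)` for all `X ∈ 𝔸_E`, `s ∈ 𝔸_F`, with the cross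
term `y× = coordY(u(X,0)·u(X_u,0))` — i.e. `Φ_g(X, s) = m·Φ_k(λ₁(X − Y), λ₂(s − y(X)))`, `m = χ(d₂)‖d₂‖^z`, `λ₁ = d₀⁻¹d₁`, `λ₂ = Λ₂`, `Y = −X_u`,
`y(X) = −(t_u + θ⁻¹y×)`. [cite: Rogawski1990, §1.10] [cite: Garrett2018, §2.9] -/
theorem bigCell_heisenberg_dilation_three (hc : c * c = 1) (hcδ : c δ = -δ) (hδ : δ ≠ 0) (χ : HeckeCharacter E) (z : ℂ)
    {f : (quasiSplit F E c 3).Adelic → ℂ}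
    (hf : ∀ (b g : (quasiSplit F E c 3).Adelic) (hb : b ∈ borelAdelic F E c 3),
      f (b * g) = ((χ (diagUnit hb 0) : ℂˣ) : ℂ) * ((ideleNorm (diagUnit hb 0) : ℝ) : ℂ) ^ z * f g)
    (t : ↥(torusInBorel F E c 3)) (Λ₂ : (AdeleRing (𝓞 F) F)ˣ)
    (hΛ₂ : ((AdeleRing.ideleBaseChange F E Λ₂ : (AdeleRing (𝓞 E) E)ˣ) : AdeleRing (𝓞 E) E) = (((diagUnit (t : borelAdelic F E c 3).2 0)⁻¹ * diagUnit (t : borelAdelic F E c 3).2 2 : (AdeleRing (𝓞 E) E)ˣ) : AdeleRing (𝓞 E) E))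
    (Xu : AdeleRing (𝓞 E) E) (tu : AdeleRing (𝓞 F) F) (k : (quasiSplit F E c 3).Adelic) (X : AdeleRing (𝓞 E) E) (s : AdeleRing (𝓞 F) F) :
    f (((quasiSplit F E c 3).toAdelic (weylLongU (c : E →+* E) (rfl : (StdForm.antidiagonal 3).over E = (StdForm.antidiagonal 3).over E))) * ((heisChart hc (X, traceZeroLine F E c hcδ hδ s) : adelicUnipotent F E c 3) : (quasiSplit F E c 3).Adelic) *
        (((heisChart hc (Xu, traceZeroLine F E c hcδ hδ tu) : adelicUnipotent F E c 3) : (quasiSplit F E c 3).Adelic) * ((t : borelAdelic F E c 3) : (quasiSplit F E c 3).Adelic) * k)) =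
      (((χ (diagUnit (t : borelAdelic F E c 3).2 2) : ℂˣ) : ℂ) * ((ideleNorm (diagUnit (t : borelAdelic F E c 3).2 2) : ℝ) : ℂ) ^ z) *
        f (((quasiSplit F E c 3).toAdelic (weylLongU (c : E →+* E) (rfl : (StdForm.antidiagonal 3).over E = (StdForm.antidiagonal 3).over E))) *
          ((heisChart hc ((((diagUnit (t : borelAdelic F E c 3).2 0)⁻¹ * diagUnit (t : borelAdelic F E c 3).2 1 : (AdeleRing (𝓞 E) E)ˣ) : AdeleRing (𝓞 E) E) * (X - -Xu), traceZeroLine F E c hcδ hδ ((Λ₂ : AdeleRing (𝓞 F) F) * (s - -(tu + (traceZeroLine F E c hcδ hδ).symm (coordY hc (heisChart hc (X, (0 : traceZeroAdele F E c)) * heisChart hc (Xu, (0 : traceZeroAdele F E c)))))))) : adelicUnipotent F E c 3) : (quasiSplit F E c 3).Adelic) * k) := by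
  have hW := toAdelic_weylLongU_mul_self_three (F := F) (E := E) (c := c)
  -- the Heisenberg law, then the torus conjugation
  have hmul : ((heisChart hc (X, traceZeroLine F E c hcδ hδ s) : adelicUnipotent F E c 3) : (quasiSplit F E c 3).Adelic) * ((heisChart hc (Xu, traceZeroLine F E c hcδ hδ tu) : adelicUnipotent F E c 3) : (quasiSplit F E c 3).Adelic) =
      ((heisChart hc (X + Xu, traceZeroLine F E c hcδ hδ (s + tu + (traceZeroLine F E c hcδ hδ).symm (coordY hc (heisChart hc (X, (0 : traceZeroAdele F E c)) * heisChart hc (Xu, (0 : traceZeroAdele F E c)))))) : adelicUnipotent F E c 3) : (quasiSplit F E c 3).Adelic) := by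
    rw [← Subgroup.coe_mul, heisChart_traceZeroLine_mul]
  have hconj := torus_inv_mul_heisChart_traceZeroLine_mul_torus hc hcδ hδ t Λ₂ hΛ₂ (X + Xu) (s + tu + (traceZeroLine F E c hcδ hδ).symm (coordY hc (heisChart hc (X, (0 : traceZeroAdele F E c)) * heisChart hc (Xu, (0 : traceZeroAdele F E c)))))
  have key : ((quasiSplit F E c 3).toAdelic (weylLongU (c : E →+* E) (rfl : (StdForm.antidiagonal 3).over E = (StdForm.antidiagonal 3).over E))) * ((heisChart hc (X, traceZeroLine F E c hcδ hδ s) : adelicUnipotent F E c 3) : (quasiSplit F E c 3).Adelic) *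
        (((heisChart hc (Xu, traceZeroLine F E c hcδ hδ tu) : adelicUnipotent F E c 3) : (quasiSplit F E c 3).Adelic) * ((t : borelAdelic F E c 3) : (quasiSplit F E c 3).Adelic) * k) =
      (((quasiSplit F E c 3).toAdelic (weylLongU (c : E →+* E) (rfl : (StdForm.antidiagonal 3).over E = (StdForm.antidiagonal 3).over E))) * ((t : borelAdelic F E c 3) : (quasiSplit F E c 3).Adelic) * ((quasiSplit F E c 3).toAdelic (weylLongU (c : E →+* E) (rfl : (StdForm.antidiagonal 3).over E = (StdForm.antidiagonal 3).over E)))) *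
        (((quasiSplit F E c 3).toAdelic (weylLongU (c : E →+* E) (rfl : (StdForm.antidiagonal 3).over E = (StdForm.antidiagonal 3).over E))) * (((t : borelAdelic F E c 3) : (quasiSplit F E c 3).Adelic)⁻¹ * ((heisChart hc (X + Xu, traceZeroLine F E c hcδ hδ (s + tu + (traceZeroLine F E c hcδ hδ).symm (coordY hc (heisChart hc (X, (0 : traceZeroAdele F E c)) * heisChart hc (Xu, (0 : traceZeroAdele F E c)))))) : adelicUnipotent F E c 3) : (quasiSplit F E c 3).Adelic) * ((t : borelAdelic F E c 3) : (quasiSplit F E c 3).Adelic)) * k) := by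
    rw [← hmul]
    simp only [mul_assoc]
    rw [← mul_assoc ((quasiSplit F E c 3).toAdelic (weylLongU (c : E →+* E) (rfl : (StdForm.antidiagonal 3).over E = (StdForm.antidiagonal 3).over E)))
      ((quasiSplit F E c 3).toAdelic (weylLongU (c : E →+* E) (rfl : (StdForm.antidiagonal 3).over E = (StdForm.antidiagonal 3).over E))), hW, one_mul, mul_inv_cancel_left]
  rw [key, hconj, hf _ _ (weylLong_conj_torus_mem_borelAdelic_three t), diagUnit_weylLong_conj_torus_zero_three]
  simp only [sub_neg_eq_add, add_assoc]

/-! ## §5 The scalars: `‖d₁‖ = 1`, `‖d₂‖ = ‖d₀‖⁻¹`, `|Λ₂|_F = ‖d₀‖⁻¹ = |d₀⁻¹d₁|_E`, `‖m‖ = |Λ₂|_F^{Re z}`, and `Λ₂` exists -/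

omit [Algebra.IsQuadraticExtension F E] in
/-- **On the torus of `U(J₃)`: `‖d₁‖_E = 1` and `‖d₂‖_E = ‖d₀‖_E⁻¹`** (★ `torus_relations`: `c(d₁)d₁ = 1`, `c(d₀)d₂ = 1`; ★ `ideleNorm_galSmul`). [cite: Rogawski1990, §1.10] -/
theorem ideleNorm_torus_three (t : ↥(torusInBorel F E c 3)) :
    IdeleClassGroup.ideleNorm E (diagUnit (t : borelAdelic F E c 3).2 1) = 1 ∧
      IdeleClassGroup.ideleNorm E (diagUnit (t : borelAdelic F E c 3).2 2) = (IdeleClassGroup.ideleNorm E (diagUnit (t : borelAdelic F E c 3).2 0))⁻¹ := by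
  obtain ⟨-, h11, h02⟩ := torus_relations t (glDiagonal_diagUnit_torus t)
  have hunit : ∀ {i j : Fin 3}, conjAdele F E c (diagUnit (t : borelAdelic F E c 3).2 i : AdeleRing (𝓞 E) E) * diagUnit (t : borelAdelic F E c 3).2 j = 1 →
      (Units.map (MulSemiringAction.toRingHom (E ≃ₐ[F] E) (AdeleRing (𝓞 E) E) c : _ →* _) (diagUnit (t : borelAdelic F E c 3).2 i)) * diagUnit (t : borelAdelic F E c 3).2 j = 1 := by
    intro i j h
    ext
    rw [Units.val_mul, Units.coe_map, MonoidHom.coe_coe, MulSemiringAction.toRingHom_apply, Units.val_one, ← conjAdele_apply]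
    exact h
  constructor
  · have h := congrArg (IdeleClassGroup.ideleNorm E) (hunit h11)
    rw [map_mul, UnitaryGroup.ideleNorm_galSmul c, map_one, ← sq] at h
    exact (pow_left_inj₀ zero_le zero_le two_ne_zero).1 (h.trans (one_pow 2).symm)
  · apply eq_inv_of_mul_eq_one_right
    have h := congrArg (IdeleClassGroup.ideleNorm E) (hunit h02)
    rwa [map_mul, UnitaryGroup.ideleNorm_galSmul c, map_one] at h

/-- **`|Λ₂|_F = ‖d₀‖_E⁻¹`** for the central scalar (`‖(Λ₂)_E‖_E = |Λ₂|_F²` ★ `ideleNorm_ideleBaseChange`, `‖d₀⁻¹d₂‖ = ‖d₀‖⁻²`). [cite: Rogawski1990, §1.10] -/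
theorem ideleNorm_centralScalar_three (t : ↥(torusInBorel F E c 3)) (Λ₂ : (AdeleRing (𝓞 F) F)ˣ)
    (hΛ₂ : ((AdeleRing.ideleBaseChange F E Λ₂ : (AdeleRing (𝓞 E) E)ˣ) : AdeleRing (𝓞 E) E) = (((diagUnit (t : borelAdelic F E c 3).2 0)⁻¹ * diagUnit (t : borelAdelic F E c 3).2 2 : (AdeleRing (𝓞 E) E)ˣ) : AdeleRing (𝓞 E) E)) :
    IdeleClassGroup.ideleNorm F Λ₂ = (IdeleClassGroup.ideleNorm E (diagUnit (t : borelAdelic F E c 3).2 0))⁻¹ := by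
  have hΛ' : AdeleRing.ideleBaseChange F E Λ₂ = (diagUnit (t : borelAdelic F E c 3).2 0)⁻¹ * diagUnit (t : borelAdelic F E c 3).2 2 := Units.ext hΛ₂
  have h := Literature.NumberTheory.AdelicBaseChange.ideleNorm_ideleBaseChange (K := F) (L := E) Λ₂
  rw [hΛ', map_mul, map_inv, (ideleNorm_torus_three t).2, Algebra.IsQuadraticExtension.finrank_eq_two F E, ← sq] at h
  exact ((pow_left_inj₀ zero_le zero_le two_ne_zero).1 h).symm

omit [Algebra.IsQuadraticExtension F E] in
/-- **`|d₀⁻¹d₁|_E = ‖d₀‖_E⁻¹`** (the root dilation on `N∕Z ≅ 𝔸_E`; `‖d₁‖ = 1`). [cite: Rogawski1990, §1.10] -/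
theorem ideleNorm_rootScalar_three (t : ↥(torusInBorel F E c 3)) :
    IdeleClassGroup.ideleNorm E ((diagUnit (t : borelAdelic F E c 3).2 0)⁻¹ * diagUnit (t : borelAdelic F E c 3).2 1) = (IdeleClassGroup.ideleNorm E (diagUnit (t : borelAdelic F E c 3).2 0))⁻¹ := by
  rw [map_mul, map_inv, (ideleNorm_torus_three t).1, mul_one]

/-- **`‖m‖ = |Λ₂|_F^σ`** for `m = χ(d₂)‖d₂‖_E^z`, `σ = Re z` (the `hm` of ★ `norm_sub_borelConstantTerm_le_const_three`), together with `|d₀⁻¹d₁|_E = |Λ₂|_F`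
(its `hL`). [cite: Garrett2018, §2.9] -/
theorem norm_multiplier_eq_rpow_three (χ : HeckeCharacter E) (hχ : χ.IsUnitary) (z : ℂ) (t : ↥(torusInBorel F E c 3)) (Λ₂ : (AdeleRing (𝓞 F) F)ˣ)
    (hΛ₂ : ((AdeleRing.ideleBaseChange F E Λ₂ : (AdeleRing (𝓞 E) E)ˣ) : AdeleRing (𝓞 E) E) = (((diagUnit (t : borelAdelic F E c 3).2 0)⁻¹ * diagUnit (t : borelAdelic F E c 3).2 2 : (AdeleRing (𝓞 E) E)ˣ) : AdeleRing (𝓞 E) E)) :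
    ‖((χ (diagUnit (t : borelAdelic F E c 3).2 2) : ℂˣ) : ℂ) * ((ideleNorm (diagUnit (t : borelAdelic F E c 3).2 2) : ℝ) : ℂ) ^ z‖ = ((IdeleClassGroup.ideleNorm F Λ₂ : ℝ≥0) : ℝ) ^ z.re ∧
      ((IdeleClassGroup.ideleNorm E ((diagUnit (t : borelAdelic F E c 3).2 0)⁻¹ * diagUnit (t : borelAdelic F E c 3).2 1) : ℝ≥0) : ℝ) = ((IdeleClassGroup.ideleNorm F Λ₂ : ℝ≥0) : ℝ) := by
  refine ⟨?_, ?_⟩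
  · rw [norm_chi_mul_ideleNorm_cpow χ hχ, ← coe_ideleNorm, (ideleNorm_torus_three t).2, ideleNorm_centralScalar_three t Λ₂ hΛ₂]
  · rw [ideleNorm_rootScalar_three, ideleNorm_centralScalar_three t Λ₂ hΛ₂]

/-- **THE CENTRAL SCALAR IS AN IDELE OF `F`**: there is `Λ₂ ∈ 𝕀_F` with `(Λ₂)_E = d₀⁻¹d₂` (`c ⊗ 1`-fixed ★ `conjAdele_torusCentralScalar`; quadratic descent
★ `exists_baseChange_eq_of_conjAdele_eq`).  It is `N_{E∕F}(d₀)⁻¹`. [cite: Rogawski1990, §1.10] [cite: CasselsFrohlichANT1967, Ch. II §14] -/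
theorem exists_centralScalar_three (hcδ : c δ = -δ) (hδ : δ ≠ 0) (t : ↥(torusInBorel F E c 3)) :
    ∃ Λ₂ : (AdeleRing (𝓞 F) F)ˣ, ((AdeleRing.ideleBaseChange F E Λ₂ : (AdeleRing (𝓞 E) E)ˣ) : AdeleRing (𝓞 E) E) = (((diagUnit (t : borelAdelic F E c 3).2 0)⁻¹ * diagUnit (t : borelAdelic F E c 3).2 2 : (AdeleRing (𝓞 E) E)ˣ) : AdeleRing (𝓞 E) E) := by
  have hx := conjAdele_torusCentralScalar t (glDiagonal_diagUnit_torus t)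
  have hx' : conjAdele F E c ((((diagUnit (t : borelAdelic F E c 3).2 0)⁻¹ * diagUnit (t : borelAdelic F E c 3).2 2 : (AdeleRing (𝓞 E) E)ˣ)⁻¹ : (AdeleRing (𝓞 E) E)ˣ) : AdeleRing (𝓞 E) E) = ((((diagUnit (t : borelAdelic F E c 3).2 0)⁻¹ * diagUnit (t : borelAdelic F E c 3).2 2 : (AdeleRing (𝓞 E) E)ˣ)⁻¹ : (AdeleRing (𝓞 E) E)ˣ) : AdeleRing (𝓞 E) E) := by
    have h1 : conjAdele F E c ((((diagUnit (t : borelAdelic F E c 3).2 0)⁻¹ * diagUnit (t : borelAdelic F E c 3).2 2 : (AdeleRing (𝓞 E) E)ˣ)⁻¹ : (AdeleRing (𝓞 E) E)ˣ) : AdeleRing (𝓞 E) E) * (((diagUnit (t : borelAdelic F E c 3).2 0)⁻¹ * diagUnit (t : borelAdelic F E c 3).2 2 : (AdeleRing (𝓞 E) E)ˣ) : AdeleRing (𝓞 E) E) = 1 := by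
      conv_lhs => rw [← hx]
      rw [← map_mul, Units.inv_mul, map_one]
    exact Units.eq_inv_of_mul_eq_one_right h1
  obtain ⟨a, ha⟩ := UnitaryGroup.exists_baseChange_eq_of_conjAdele_eq E c hcδ hδ hx
  obtain ⟨a', ha'⟩ := UnitaryGroup.exists_baseChange_eq_of_conjAdele_eq E c hcδ hδ hx'
  have haa' : a * a' = 1 := AdeleRing.baseChange_injective F E (by rw [map_mul, ha, ha', Units.mul_inv, map_one])
  have ha'a : a' * a = 1 := by rw [mul_comm]; exact haa'
  exact ⟨⟨a, a', haa', ha'a⟩, by rw [AdeleRing.coe_ideleBaseChange]; exact ha⟩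

end Summit.HodgeConjecture.HodgeConjecture.Cruxes.H413.K2E1BigCellHeisenbergDilationU3

end
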